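import Summits.ABC.StewartYu.PadicTwistHalfStep
import Literature.NumberTheory.Transcendental.PadicCW77Assembly
import HarnessLib

/-!
# Cell abc-stewartyu, WP-Y3 (ix): the parameter pack of the TWISTED machine, the log-form of the
# numerical inequalities, and the half-step junction

`Summits/ABC/StewartYu/PadicTwistAssembly.lean` — cell `abc-stewartyu` (seat p2; cruxes
`W80ThreeModFour` / `FinBoundThreeModFour` of the PATH-Z routes, fallback crux stmt-ABC-19249),
sequel to `PadicTwistHalfStep.lean`.  Plain definitions and theorems; no named fact.  TWIN of the
assembly layer of the principal-unit chain (p2's `PadicCW77Assembly.ParamPack`,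
`kFinal_of_log_ineq`; p3's `PadicCW77Junctions.HSizesHalf/HFinalHalf/halfStep_of/
hFinalHalf_of_log_ineq`) for `S : TwistSetup p`:

* `ParamPack S U` — box/descent parameters, size functions, and the inputs of `TwistSetup.main`
  (Siegel on a class at level `0`, the endgame, and — under `‖Λ₀‖_p ≤ e^{−U}` — the inner-step
  inequalities and the classed half steps); `norm_Λ₀_gt_of_paramPack : e^{−U} < ‖Λ₀‖_p`;
* `kFinal_of_log_ineq` — `KFinal` from the two log-inequalities WITH `log p` SYMBOLIC (the form p1's
  `(log p)`-normalised ledger `PadicW80ParL*` delivers; NOT the `p`-free form);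
* `HSizesHalf`, `HFinalHalf`, `halfStep_of`, `hFinalHalf_of_log_ineq` — the classed half step from
  sizes and the half-point inequality (provider A of `PadicTwistHalfStep`).

## References
* [Yu1990] K. Yu, *Linear forms in p-adic logarithms II*, Compositio Math. 74 (1990), §2,
  Proposition 2.1.
* [Waldschmidt1980] M. Waldschmidt, Acta Arith. 37 (1980), §§3.2–3.5.
-/

noncomputable section

open NormedSpace Finset IsUltrametricDist
open Literature.NumberTheory.Transcendental
open Literature.NumberTheory.Transcendental.CW77 (heightProd)
open Literature.NumberTheory.Transcendental.PadicCW77 (condExp)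
open scoped Nat

namespace Summit.ABC.StewartYu

open Literature.NumberTheory.Transcendental.CW77.Setup (Idx Tau tauNorm)

namespace TwistSetup

variable {p : ℕ} [Fact p.Prime] (S : TwistSetup p)

/-! ### The parameter pack -/

/-- **A parameter pack for the twisted set-up `S` at exponent `U`**: box parameters `h, Lb`, descent
parameters `J₀, L, L_θ, S₀, T, P, t`, size functions `Dmax, Mmax`, and the inputs of
`TwistSetup.main`: `S₀` even, `1 ≤ t J`, `(d+1) t J ≤ ⌊T/2^J⌋`, `log p ≤ U`, the sizes `KSizes`,
Siegel on a class at level `0`, the endgame at level `J₀`, and — under `‖Λ₀‖_p ≤ e^{−U}` — the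
inequalities `KFinal` and the classed half steps. [cite: Yu1990, Proposition 2.1]
[cite: Waldschmidt1980, §§3.2–3.5 (pp. 264–274)] -/
structure ParamPack (U : ℝ) where
  /-- `h`: number of `Δ`-polynomials `Δ(X;r)`, `r < h` -/
  h : ℕ
  /-- `Lb`: range of the exponent of `Δ(X;h)` -/
  Lb : ℕ
  /-- the depth of the descent -/
  J₀ : ℕ
  /-- ranges of the free exponents -/
  L : Fin S.d → ℕ
  /-- range of the eliminated exponent -/
  Lθ : ℕ
  /-- number of points at level `0` -/
  S₀ : ℕ
  /-- number of derivatives at level `0` -/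
  T : ℕ
  /-- the integer bound for the coefficients -/
  P : ℤ
  /-- multiplicity of the inner steps at level `J` -/
  t : ℕ → ℕ
  /-- denominator bounds `Dmax J k` -/
  Dmax : ℕ → ℕ → ℝ
  /-- archimedean size bounds `Mmax J k` -/
  Mmax : ℕ → ℕ → ℝ
  /-- `S₀` is even -/
  hS₀ : Even S₀
  /-- `t J ≥ 1` -/
  ht : ∀ J, J < J₀ → 1 ≤ t J
  /-- room for the inner chain -/
  htT : ∀ J, J < J₀ → (S.d + 1) * t J ≤ T / 2 ^ J
  /-- `log p ≤ U` (so that `e^{−U} ≤ p⁻¹`) -/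
  hUp : Real.log p ≤ U
  /-- the archimedean sizes of the cores at every level -/
  hsz : ∀ J, J < J₀ → ∀ pv : Idx S.d h Lb → ℤ, S.Inv J₀ L Lθ S₀ T P J pv →
    S.KSizes J₀ J L Lθ S₀ T (t J) pv (Dmax J) (Mmax J)
  /-- the numerical inequalities of the inner steps, from the smallness of `Λ₀` -/
  hfin : ‖S.Λ₀‖ ≤ Real.exp (-U) → ∀ J, J < J₀ → S.KFinal (h := h) (Lb := Lb) J S₀ (t J) (Dmax J) (Mmax J)
  /-- the classed half steps, from the smallness of `Λ₀` -/
  hhalf : ‖S.Λ₀‖ ≤ Real.exp (-U) → ∀ J, J < J₀ → S.HalfStep (h := h) (Lb := Lb) J₀ J L Lθ S₀ T (t J) P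
  /-- Siegel's lemma on a class at level `0` -/
  hsiegel : S.Siegel (h := h) (Lb := Lb) J₀ L Lθ S₀ T P
  /-- the contradiction at level `J₀` -/
  hend : S.Endgame (h := h) (Lb := Lb) J₀ L Lθ S₀ T P

/-- **A parameter pack at exponent `U` forbids `‖Λ₀‖_p ≤ e^{−U}`.** [cite: Yu1990, Proposition 2.1] -/
theorem not_norm_Λ₀_le_of_paramPack {U : ℝ} (pk : S.ParamPack U) : ¬ ‖S.Λ₀‖ ≤ Real.exp (-U) := by
  intro hle
  have hp0 : (0 : ℝ) < p := by linarith [S.one_lt_p]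
  have hΛ : ‖S.Λ₀‖ ≤ (p : ℝ)⁻¹ := by
    refine hle.trans ?_
    rw [← Real.exp_log hp0, ← Real.exp_neg, Real.exp_le_exp]
    exact neg_le_neg pk.hUp
  exact S.main pk.hS₀ pk.ht pk.htT hΛ pk.hsz (pk.hfin hle) (pk.hhalf hle) pk.hsiegel pk.hend

/-- **Packs are monotone in the exponent.** [cite: Waldschmidt1980, Prop. 3.8 (p. 263)] -/
def ParamPack.mono {S : TwistSetup p} {U U' : ℝ} (pk : S.ParamPack U) (hU : U ≤ U') : S.ParamPack U' where
  h := pk.h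
  Lb := pk.Lb
  J₀ := pk.J₀
  L := pk.L
  Lθ := pk.Lθ
  S₀ := pk.S₀
  T := pk.T
  P := pk.P
  t := pk.t
  Dmax := pk.Dmax
  Mmax := pk.Mmax
  hS₀ := pk.hS₀
  ht := pk.ht
  htT := pk.htT
  hUp := pk.hUp.trans hU
  hsz := pk.hsz
  hfin hΛ := pk.hfin (hΛ.trans (Real.exp_le_exp.mpr (neg_le_neg hU)))
  hhalf hΛ := pk.hhalf (hΛ.trans (Real.exp_le_exp.mpr (neg_le_neg hU)))
  hsiegel := pk.hsiegel
  hend := pk.hend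

/-- From a pack at any exponent `U ≤ U'`: `‖Λ₀‖_p > e^{−U'}`. [cite: Waldschmidt1980, Prop. 3.8] -/
theorem norm_Λ₀_gt_of_paramPack_le {S : TwistSetup p} {U U' : ℝ} (hU : U ≤ U') (pk : S.ParamPack U) :
    Real.exp (-U') < ‖S.Λ₀‖ :=
  not_le.mp (S.not_norm_Λ₀_le_of_paramPack (pk.mono hU))

/-! ### The inner-step inequality in logarithmic form, `log p` symbolic -/

/-- `(√p)^n = exp((n/2) log p)`. [folklore] -/
theorem sqrt_pow_eq_exp (S : TwistSetup p) (n : ℕ) :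
    Real.sqrt p ^ n = Real.exp ((n : ℝ) / 2 * Real.log p) := by
  have hp0 : (0 : ℝ) < p := by linarith [S.one_lt_p]
  rw [Real.sqrt_eq_rpow, ← Real.rpow_natCast, ← Real.rpow_mul hp0.le, Real.rpow_def_of_pos hp0]
  congr 1; ring

/-- `p^n = exp(n log p)`. [folklore] -/
theorem natPow_eq_exp (S : TwistSetup p) (n : ℕ) : (p : ℝ) ^ n = Real.exp ((n : ℝ) * Real.log p) := by
  have hp0 : (0 : ℝ) < p := by linarith [S.one_lt_p]
  rw [← Real.rpow_natCast, Real.rpow_def_of_pos hp0]; congr 1; ring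

/-- **`KFinal` from two inequalities between logarithms, `log p` SYMBOLIC**: with
`kpts = 2^{k+J} S₀ / 2`, if `‖Λ₀‖_p ≤ e^{−U}` and for every `k < d`
(1) `(⌊hLb/(p−1)⌋ + ⌊(t−1)/(p−1)⌋ + condExp)·log p + log(Dmax·Mmax) < U` and
(2) `hLb·log p + log(Dmax·Mmax) < (kpts·t/2)·log p`, then `KFinal J S₀ t Dmax Mmax` — the Schwarz
gain is `(log p)/2` PER ZERO (Yu's `(f℘ log p)^{−(n+2)}` normalisation lives in (2)).
[cite: Yu1990, §2.2 (2.33)] [cite: Waldschmidt1980, Lemma 3.6 (p. 272)] -/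
theorem kFinal_of_log_ineq {h Lb : ℕ} {U : ℝ} (J S₀ t : ℕ) (Dmax Mmax : ℕ → ℝ)
    (hΛ : ‖S.Λ₀‖ ≤ Real.exp (-U)) (hDM : ∀ k, k < S.d → 0 < Dmax k ∧ 0 < Mmax k)
    (h1 : ∀ k, k < S.d →
      ((h * Lb / (p - 1) + (t - 1) / (p - 1) + condExp p (2 ^ (k + J) * S₀ / 2) t : ℕ) : ℝ) *
          Real.log p + Real.log (Dmax k * Mmax k) < U)
    (h2 : ∀ k, k < S.d →
      ((h * Lb : ℕ) : ℝ) * Real.log p + Real.log (Dmax k * Mmax k) <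
        (((2 ^ (k + J) * S₀ / 2) * t : ℕ) : ℝ) / 2 * Real.log p) :
    S.KFinal (h := h) (Lb := Lb) J S₀ t Dmax Mmax := by
  intro k hk
  obtain ⟨hD, hM⟩ := hDM k hk
  have hDM0 : 0 < Dmax k * Mmax k := mul_pos hD hM
  have hinv : 1 / (Dmax k * Mmax k) = Real.exp (-Real.log (Dmax k * Mmax k)) := by
    rw [Real.exp_neg, Real.exp_log hDM0, one_div]
  rw [hinv]
  refine max_lt ?_ ?_
  · rcases (norm_nonneg S.Λ₀).eq_or_lt with h0 | hpos
    · rw [← h0]; simp [Real.exp_pos]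
    · have e1 : (p : ℝ) ^ (h * Lb / (p - 1)) * ‖S.Λ₀‖ * (p : ℝ) ^ ((t - 1) / (p - 1)) *
          (p : ℝ) ^ condExp p (2 ^ (k + J) * S₀ / 2) t =
          Real.exp (((h * Lb / (p - 1) : ℕ) : ℝ) * Real.log p + Real.log ‖S.Λ₀‖ +
            (((t - 1) / (p - 1) : ℕ) : ℝ) * Real.log p +
            (condExp p (2 ^ (k + J) * S₀ / 2) t : ℝ) * Real.log p) := by
        rw [S.natPow_eq_exp, S.natPow_eq_exp, S.natPow_eq_exp, ← Real.exp_log hpos]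
        simp only [← Real.exp_add, Real.log_exp]
      rw [e1, Real.exp_lt_exp]
      have hlog : Real.log ‖S.Λ₀‖ ≤ -U := by
        have := Real.log_le_log hpos hΛ; rwa [Real.log_exp] at this
      have h1k := h1 k hk
      push_cast at h1k ⊢
      linarith
  · have e2 : (p : ℝ) ^ (h * Lb) / Real.sqrt p ^ ((2 ^ (k + J) * S₀ / 2) * t) =
        Real.exp (((h * Lb : ℕ) : ℝ) * Real.log p -
          (((2 ^ (k + J) * S₀ / 2) * t : ℕ) : ℝ) / 2 * Real.log p) := by
      rw [S.natPow_eq_exp, S.sqrt_pow_eq_exp, ← Real.exp_sub]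
    rw [e2, Real.exp_lt_exp]
    have h2k := h2 k hk
    linarith

/-! ### The classed half step from sizes and the half-point inequality -/

variable {h Lb : ℕ}

/-- **Archimedean sizes at the half points of level `J`** (from the heights: `Dhalf♭` and the
`ℓ¹`-norm of the signed class-sum vector for every admissible classed coefficient vector).
[cite: Waldschmidt1980, §3.4 (p. 272)] -/
def HSizesHalf (J₀ J : ℕ) (L : Fin S.d → ℕ) (Lθ S₀ T : ℕ) (P : ℤ) (DmaxH MmaxH : ℝ) : Prop :=
  1 ≤ MmaxH ∧ ∀ pv : Idx S.d h Lb → ℤ, S.Inv J₀ L Lθ S₀ T P J pv →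
    ∀ s, s < 2 ^ (J + 1) * S₀ → Odd s → ∀ τ : Tau S.d, tauNorm τ < T / 2 ^ (J + 1) →
      ((S.toQ.flat.Dhalf (h := h) J₀ J L Lθ s τ : ℕ) : ℝ) ≤ DmaxH ∧
      ∑ T', |(S.toQ.classVec J₀ J (S.toQ.flat.box (h := h) (Lb := Lb) L Lθ J) pv τ s T' : ℝ)| ≤ MmaxH

/-- **The half-point inequality at level `J`**: the Schwarz bound at `kpts = 2^{d+J} S₀/2` nodes of
multiplicity `t` is below the sharp `p`-adic Liouville bound of the class sums.
[cite: Yu1990, §2.4 Lemma 2.4] -/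
def HFinalHalf (J : ℕ) (S₀ t : ℕ) (DmaxH MmaxH : ℝ) : Prop :=
  max ((p : ℝ) ^ (h * Lb / (p - 1)) * ‖S.Λ₀‖ * (p : ℝ) ^ ((t - 1) / (p - 1)) *
        (p : ℝ) ^ condExp p (2 ^ (S.d + J) * S₀ / 2) t)
      ((p : ℝ) ^ (h * Lb) / Real.sqrt p ^ ((2 ^ (S.d + J) * S₀ / 2) * t)) <
    DmaxH / (4 * DmaxH ^ 2 * MmaxH * heightProd S.toQ.all ^ 3) ^ (2 ^ (S.d + 1))

/-- **The classed half step from sizes and the half-point inequality** (provider A: everything in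
`ℚ_p`). [cite: Yu1990, §2.4 Lemmas 2.4–2.5] -/
theorem halfStep_of (hodd : Odd S.G) {J₀ J : ℕ} (hJ : J < J₀)
    (hind : ∀ T' : Finset (Fin (S.d + 1)), T'.Nonempty → ¬ IsSquare (∏ i ∈ T', S.toQ.all i))
    (hΛ : ‖S.Λ₀‖ ≤ (p : ℝ)⁻¹) {L : Fin S.d → ℕ} {Lθ S₀ T t : ℕ} {P : ℤ} (ht : 1 ≤ t)
    (hroom : T / 2 ^ (J + 1) + t ≤ T / 2 ^ J - S.d * t) {DmaxH MmaxH : ℝ}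
    (hsz : S.HSizesHalf (h := h) (Lb := Lb) J₀ J L Lθ S₀ T P DmaxH MmaxH)
    (hfin : S.HFinalHalf (h := h) (Lb := Lb) J S₀ t DmaxH MmaxH) :
    S.HalfStep (h := h) (Lb := Lb) J₀ J L Lθ S₀ T t P := by
  intro pv inv hvan
  obtain ⟨ρ, hρG, hcls⟩ := inv.cls
  have hsmall : ∀ s, s < 2 ^ (J + 1) * S₀ → Odd s → ∀ τ : Tau S.d, tauNorm τ < T / 2 ^ (J + 1) →
      ‖S.Φ J₀ J (S.toQ.flat.box (h := h) (Lb := Lb) L Lθ J) pv τ ((2 : ℚ_[p])⁻¹ * (s : ℚ_[p]))‖ <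
        DmaxH / (4 * DmaxH ^ 2 * MmaxH * heightProd S.toQ.all ^ 3) ^ (2 ^ (S.d + 1)) := by
    intro s hs hso τ hτ
    have hzero : ∀ i < 2 ^ (S.d + J) * S₀ / 2, ∀ τ'' : Tau S.d, tauNorm τ'' < T / 2 ^ J - S.d * t →
        S.toQ.coreSum J₀ J (S.toQ.flat.box (h := h) (Lb := Lb) L Lθ J) pv τ'' (2 * i + 1) = 0 := by
      intro i hi τ'' hτ''
      have h2i : 2 * i + 1 < 2 ^ (S.d + J) * S₀ := by omega
      exact hvan (2 * i + 1) h2i ⟨i, rfl⟩ τ'' hτ''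
    have hz : ‖(2 : ℚ_[p])⁻¹ * (s : ℚ_[p])‖ ≤ 1 := by
      rw [norm_mul, norm_inv, PadicExp.norm_two_eq_one S.hp3, inv_one, one_mul]
      exact_mod_cast Padic.norm_int_le_one (p := p) (s : ℤ)
    have hτt : tauNorm τ + t ≤ T / 2 ^ J - S.d * t := by omega
    have hzeroΦ : ∀ i < 2 ^ (S.d + J) * S₀ / 2, ∀ τ'' : Tau S.d, tauNorm τ'' < T / 2 ^ J - S.d * t →
        S.Φ J₀ J (S.toQ.flat.box (h := h) (Lb := Lb) L Lθ J) pv τ'' ((2 * i + 1 : ℕ) : ℚ_[p]) = 0 :=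
      fun i hi τ'' hτ'' => by
        rw [S.Φ_natCast J₀ J _ pv τ'' (fun u _ hu => hcls u hu), hzero i hi τ'' hτ'', Rat.cast_zero, mul_zero]
    have key := (S.norm_Φ_le_of_zeros J₀ J (S.toQ.flat.box (h := h) (Lb := Lb) L Lθ J) pv
      ht hzeroΦ hΛ hz τ hτt).2
    exact lt_of_le_of_lt key hfin
  exact S.inv_succ_of_norm_Φ_half_lt hodd hJ hind inv hsz.1
    (fun s hs ho τ hτ => (hsz.2 pv inv s hs ho τ hτ).1) (fun s hs ho τ hτ => (hsz.2 pv inv s hs ho τ hτ).2) hsmall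

/-- **`HFinalHalf` from two inequalities between logarithms, `log p` SYMBOLIC**: with
`kpts = 2^{d+J} S₀/2` and `B = 2^{d+1}·log(4·DmaxH²·MmaxH·(∏H(allᵢ))³) − log DmaxH`, if
`‖Λ₀‖_p ≤ e^{−U}`, (1) `(⌊hLb/(p−1)⌋ + ⌊(t−1)/(p−1)⌋ + condExp)·log p + B < U` and
(2) `hLb·log p + B < (kpts·t/2)·log p`, then `HFinalHalf J S₀ t DmaxH MmaxH`.
[cite: Yu1990, §2.4 Lemma 2.4] -/
theorem hFinalHalf_of_log_ineq {U : ℝ} (J S₀ t : ℕ) {DmaxH MmaxH : ℝ}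
    (hΛ : ‖S.Λ₀‖ ≤ Real.exp (-U)) (hD : 0 < DmaxH) (hM : 0 < MmaxH)
    (h1 : ((h * Lb / (p - 1) + (t - 1) / (p - 1) + condExp p (2 ^ (S.d + J) * S₀ / 2) t : ℕ) : ℝ) *
          Real.log p +
        ((2 : ℝ) ^ (S.d + 1) * Real.log (4 * DmaxH ^ 2 * MmaxH * heightProd S.toQ.all ^ 3) -
          Real.log DmaxH) < U)
    (h2 : ((h * Lb : ℕ) : ℝ) * Real.log p +
        ((2 : ℝ) ^ (S.d + 1) * Real.log (4 * DmaxH ^ 2 * MmaxH * heightProd S.toQ.all ^ 3) -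
          Real.log DmaxH) <
        (((2 ^ (S.d + J) * S₀ / 2) * t : ℕ) : ℝ) / 2 * Real.log p) :
    S.HFinalHalf (h := h) (Lb := Lb) J S₀ t DmaxH MmaxH := by
  have hH : 1 ≤ heightProd S.toQ.all := CW77.one_le_heightProd _
  have hQ : 0 < 4 * DmaxH ^ 2 * MmaxH * heightProd S.toQ.all ^ 3 := by positivity
  have hrhs : DmaxH / (4 * DmaxH ^ 2 * MmaxH * heightProd S.toQ.all ^ 3) ^ (2 ^ (S.d + 1)) =
      Real.exp (Real.log DmaxH -
        (2 : ℝ) ^ (S.d + 1) * Real.log (4 * DmaxH ^ 2 * MmaxH * heightProd S.toQ.all ^ 3)) := by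
    have hc : (2 : ℝ) ^ (S.d + 1) * Real.log (4 * DmaxH ^ 2 * MmaxH * heightProd S.toQ.all ^ 3) =
        Real.log ((4 * DmaxH ^ 2 * MmaxH * heightProd S.toQ.all ^ 3) ^ (2 ^ (S.d + 1))) := by
      rw [Real.log_pow]; push_cast; ring
    rw [hc, Real.exp_sub, Real.exp_log hD, Real.exp_log (pow_pos hQ _)]
  unfold HFinalHalf
  rw [hrhs]
  refine max_lt ?_ ?_
  · rcases (norm_nonneg S.Λ₀).eq_or_lt with h0 | hpos
    · rw [← h0]; simp [Real.exp_pos]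
    · have e1 : (p : ℝ) ^ (h * Lb / (p - 1)) * ‖S.Λ₀‖ * (p : ℝ) ^ ((t - 1) / (p - 1)) *
          (p : ℝ) ^ condExp p (2 ^ (S.d + J) * S₀ / 2) t =
          Real.exp (((h * Lb / (p - 1) : ℕ) : ℝ) * Real.log p + Real.log ‖S.Λ₀‖ +
            (((t - 1) / (p - 1) : ℕ) : ℝ) * Real.log p +
            (condExp p (2 ^ (S.d + J) * S₀ / 2) t : ℝ) * Real.log p) := by
        rw [S.natPow_eq_exp, S.natPow_eq_exp, S.natPow_eq_exp, ← Real.exp_log hpos]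
        simp only [← Real.exp_add, Real.log_exp]
      rw [e1, Real.exp_lt_exp]
      have hlog : Real.log ‖S.Λ₀‖ ≤ -U := by
        have := Real.log_le_log hpos hΛ; rwa [Real.log_exp] at this
      push_cast at h1 ⊢
      linarith
  · have e2 : (p : ℝ) ^ (h * Lb) / Real.sqrt p ^ ((2 ^ (S.d + J) * S₀ / 2) * t) =
        Real.exp (((h * Lb : ℕ) : ℝ) * Real.log p -
          (((2 ^ (S.d + J) * S₀ / 2) * t : ℕ) : ℝ) / 2 * Real.log p) := by
      rw [S.natPow_eq_exp, S.sqrt_pow_eq_exp, ← Real.exp_sub]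
    rw [e2, Real.exp_lt_exp]
    linarith

end TwistSetup

end Summit.ABC.StewartYu

end
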